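import Summits.ABC.IUTFork.Cor312GenuineKTwistExact
import Summits.ABC.IUTFork.Cor312LicenceTripleHullCellRefuteTameSharp
import HarnessLib

/-!
# [IUTchIII] Cor. 3.12, branch C / R-W window table — the TWIST factor at a pole `p ∣ c` of an abc triple: `ord_p γ(E_{a/c}) = v_p(c)`, hence
# `v_p(c)` ODD ⟹ `2·l ∣ e(K_{x₀}/ℚ_p)` at every fibre point, and the kernel class gains the clause «`p ∣ c`, `v` odd ⇒ `2 ∣ A`»

PROOF-ONLY support file (D-0012; 0 definitions, 0 `Prop` facts, no instance) of the abc-iut cell (R-W «WINDOW Θ-SIDE INEQUALITY», seat abc-iut-W-neg-1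
gen 4, row «W:REF-BANDS-EXACT» / «W:TWIST-EXACT»; sequel of this seat's `Cor312GenuineKTwistExact` and `Cor312LicenceTripleHullCellRefuteTameSharp`).
TAKES NO SIDE on [IUTchIII] Cor. 3.12 (S. Mochizuki, *Inter-universal Teichmüller theory III*, RIMS manuscript, Cor. 3.12 p. 173–174) or on any author.

THE ARITHMETIC. For the Legendre parameter `λ = a/c` of an abc triple `a + b = c`, `γ(E_λ) = −(W₀.c₄/W₀.c₆)` (`W₀ = ⟨0, −(1+λ), 0, λ, 0⟩`) equals
`−c·(a² − ac + c²) / (2·(a + c)·(2a − c)·(a − 2c))`; at a prime `p ∣ c`, `p ≠ 2` (so `p ∤ a`), the integers `a² − ac + c² ≡ a²`, `a + c ≡ a`, `2a − c ≡ 2a`,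
`a − 2c ≡ a (mod p)` are `p`-units, whence **`ord_p γ(E_{a/c}) = v_p(c)`**. With `Cor312GenuineKTwistExact` (`γ` is a square in `F_w` at bad places):
`v_p(c)` odd ⟹ `2 ∣ e(w ∣ p)` and `2·l ∣ e(K_{x₀}/ℚ_p)` — the R-W numerics lead's desk rule «`t` odd ∧ `p ∣ c` ⇒ `{2e₀}`» (W-num-3, WINDOW-TABLE
`type_status`) for abc triples, as a theorem about the typed datum, NO model clause.

* §1 `TameRobust.ord_intCast_eq_zero_of_not_dvd` (a `p`-unit integer has `ord_p = 0`); **`RadTriple.ord_gamma_legendre_eq_factorization`** —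
  `p ∣ c`, `p ≠ 2`: `ord_p γ(E_{a/c}) = v_p(c)`.
* §2 **`GenuineK.two_mul_prime_dvd_absRamificationIdx_kOf_triple_of_odd`** — `T : ThetaVolumeDatumAt (ratPoint (a/c)) l`, `p ∣ c`, `p ∉ {2, l}`, `v_p(c)` odd:
  `2·l ∣ e(K_{x₀}/ℚ_p)` at EVERY fibre point; **`WRow.localType_class_triple_twist`** — the SHARP kernel class of `…TameSharp` plus the clause
  `p ∣ c → Odd v → 2 ∣ A` (`v = v_p(abc) = v_p(c)`).
HONEST FRAMING: bookkeeping over OUR typed objects; nothing here bears on the printed inequality of [IUTchIII] Cor. 3.12 or on the number-level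
`Cor22.Cor312AtDatum`; typed ≠ proved; instantiated ≠ endorsed. [cite: SilvermanATAEC1994, Lemma V.5.2 and Thm. V.5.3 (PDF pp. 406–409)]
[cite: DupuyHilado2025, §2.4.2] [cite: Mochizuki2012, IUTchIV Thm. 1.10 p. 22; IUTchI Ex. 3.2 (iv) p. 71] [claim: Mochizuki2012, status: disputed] for every IUT quotation.
-/

noncomputable section

open NumberField IsDedekindDomain

namespace Summit.ABC.IUTFork.Conditional

open Thm311 Thm311.Real Cor312 Cor312Prov Literature.IUT.LogVolume Literature.IUT.LogVolume.Cor22 Literature.IUT.HodgeTheaters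
  Literature.IUT.LogThetaLattice Literature.NumberTheory.NumberFields Literature.NumberTheory.DiophantineGeometry.GenEll
  Literature.NumberTheory.DiophantineGeometry

/-! ## §1. `ord_p γ(E_{a/c}) = v_p(c)` at a pole `p ∣ c`, `p ≠ 2` -/

/-- A `p`-unit INTEGER has `ord_p = 0` at the place `v` of `ℚ` over `p` (`|n|` is a natural number prime to `p`). [folklore] -/
theorem TameRobust.ord_intCast_eq_zero_of_not_dvd (v : HeightOneSpectrum (𝓞 ℚ)) {z : ℤ}
    (h : ¬ ((Rat.HeightOneSpectrum.natGenerator v : ℕ) : ℤ) ∣ z) : ord ℚ v (z : ℚ) = 0 := by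
  have hn : ¬ Rat.HeightOneSpectrum.natGenerator v ∣ z.natAbs := fun hd => h (Int.natCast_dvd.mpr hd)
  have hnat : ord ℚ v ((z.natAbs : ℕ) : ℚ) = 0 := by
    unfold ord
    rw [(UniformABCConjecture.valuation_natCast_eq_one_iff v _).2 hn, WithZero.log_one, neg_zero]
  rcases le_total 0 z with hz | hz
  · have : (z : ℚ) = ((z.natAbs : ℕ) : ℚ) := by
      rw [← Int.cast_natCast, Int.natAbs_of_nonneg hz]
    rw [this, hnat]
  · have : (z : ℚ) = -((z.natAbs : ℕ) : ℚ) := by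
      rw [← Int.cast_natCast, Int.ofNat_natAbs_of_nonpos hz, Int.cast_neg, neg_neg]
    rw [this, TameRobust.ord_neg_eq, hnat]

/-- **`γ(E_{a/c}) = −c·(a²−ac+c²) / (2·(a+c)·(2a−c)·(a−2c))`** for the Legendre curve `W₀ = ⟨0, −(1+λ), 0, λ, 0⟩`, `λ = a/c`, `c ≠ 0`
(`W₀.c₄ = 16(λ²−λ+1)`, `W₀.c₆ = 32(λ+1)(2λ−1)(λ−2)`). [cite: SilvermanATAEC1994, Lemma V.5.2 (`γ = −c₄/c₆`)] -/
theorem RadTriple.gamma_legendre_eq (a c : ℕ) (hc : c ≠ 0) (hden : (2 : ℚ) * ((a : ℚ) + c) * (2 * (a : ℚ) - c) * ((a : ℚ) - 2 * c) ≠ 0) :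
    -((⟨0, -(1 + (a : ℚ) / c), 0, (a : ℚ) / c, 0⟩ : WeierstrassCurve ℚ).c₄ /
        (⟨0, -(1 + (a : ℚ) / c), 0, (a : ℚ) / c, 0⟩ : WeierstrassCurve ℚ).c₆) =
      -((c : ℚ) * ((a : ℚ) ^ 2 - a * c + (c : ℚ) ^ 2)) / (2 * ((a : ℚ) + c) * (2 * (a : ℚ) - c) * ((a : ℚ) - 2 * c)) := by
  have hc0 : (c : ℚ) ≠ 0 := by exact_mod_cast hc
  have h2 : (2 : ℚ) ≠ 0 := by norm_num
  have hac : (a : ℚ) + c ≠ 0 := by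
    intro h; apply hden; rw [h]; ring
  have h2ac : 2 * (a : ℚ) - c ≠ 0 := by
    intro h; apply hden; rw [h]; ring
  have ha2c : (a : ℚ) - 2 * c ≠ 0 := by
    intro h; apply hden; rw [h]; ring
  have hc4 : (⟨0, -(1 + (a : ℚ) / c), 0, (a : ℚ) / c, 0⟩ : WeierstrassCurve ℚ).c₄ =
      16 * ((a : ℚ) ^ 2 - a * c + (c : ℚ) ^ 2) / (c : ℚ) ^ 2 := by
    simp only [WeierstrassCurve.c₄, WeierstrassCurve.b₂, WeierstrassCurve.b₄]
    field_simp
    ring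
  have hc6 : (⟨0, -(1 + (a : ℚ) / c), 0, (a : ℚ) / c, 0⟩ : WeierstrassCurve ℚ).c₆ =
      32 * (((a : ℚ) + c) * (2 * (a : ℚ) - c) * ((a : ℚ) - 2 * c)) / (c : ℚ) ^ 3 := by
    simp only [WeierstrassCurve.c₆, WeierstrassCurve.b₂, WeierstrassCurve.b₄, WeierstrassCurve.b₆]
    field_simp
    ring
  rw [hc4, hc6]
  field_simp
  ring

/-- **`ord_p γ(E_{a/c}) = v_p(c)` at a prime `p ∣ c`, `p ≠ 2`, of an abc triple `a + b = c`**: `γ = −c·(a²−ac+c²)/(2(a+c)(2a−c)(a−2c))` and the four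
integers `a²−ac+c²`, `a+c`, `2a−c`, `a−2c` and `2` are `p`-units (`p ∤ a` by coprimality). [cite: DupuyHilado2025, §2.4.2] -/
theorem RadTriple.ord_gamma_legendre_eq_factorization {a b c : ℕ} (habc : IsABCTriple a b c) (v : HeightOneSpectrum (𝓞 ℚ))
    (hp2 : Rat.HeightOneSpectrum.natGenerator v ≠ 2) (hpc : Rat.HeightOneSpectrum.natGenerator v ∣ c) :
    ord ℚ v (-((⟨0, -(1 + (a : ℚ) / c), 0, (a : ℚ) / c, 0⟩ : WeierstrassCurve ℚ).c₄ /
        (⟨0, -(1 + (a : ℚ) / c), 0, (a : ℚ) / c, 0⟩ : WeierstrassCurve ℚ).c₆)) =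
      (c.factorization (Rat.HeightOneSpectrum.natGenerator v) : ℤ) := by
  obtain ⟨ha, hb, hsum, hcop⟩ := habc
  set p := Rat.HeightOneSpectrum.natGenerator v with hpdef
  have hp : p.Prime := Rat.HeightOneSpectrum.prime_natGenerator v
  have hpZ : Prime (p : ℤ) := Nat.prime_iff_prime_int.mp hp
  have hc : c ≠ 0 := by omega
  have hcopac : Nat.Coprime a c := by rw [← hsum, Nat.coprime_self_add_right]; exact hcop
  have hpa : ¬ p ∣ a := fun h => hp.one_lt.ne' (Nat.eq_one_of_dvd_coprimes hcopac h hpc)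
  have hpaZ : ¬ (p : ℤ) ∣ (a : ℤ) := fun h => hpa (Int.natCast_dvd_natCast.mp h)
  have hpcZ : (p : ℤ) ∣ (c : ℤ) := Int.natCast_dvd_natCast.mpr hpc
  -- the four `p`-unit integers
  have hN : ¬ (p : ℤ) ∣ ((a : ℤ) ^ 2 - a * c + (c : ℤ) ^ 2) := by
    intro h
    have h' : (p : ℤ) ∣ (a : ℤ) ^ 2 := by
      have : (a : ℤ) ^ 2 = ((a : ℤ) ^ 2 - a * c + (c : ℤ) ^ 2) + (a - c) * c := by ring
      rw [this]; exact dvd_add h (dvd_mul_of_dvd_right hpcZ _)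
    exact hpaZ (hpZ.dvd_of_dvd_pow h')
  have hS : ¬ (p : ℤ) ∣ ((a : ℤ) + c) := by
    intro h
    exact hpaZ (by simpa using dvd_sub h hpcZ)
  have h2 : ¬ (p : ℤ) ∣ 2 := by
    intro h
    have : p ∣ 2 := by exact_mod_cast h
    exact hp2 ((Nat.prime_dvd_prime_iff_eq hp Nat.prime_two).mp this)
  have hD : ¬ (p : ℤ) ∣ (2 * (a : ℤ) - c) := by
    intro h
    have h' : (p : ℤ) ∣ 2 * (a : ℤ) := by simpa using dvd_add h hpcZ
    rcases hpZ.dvd_or_dvd h' with h2' | ha'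
    · exact h2 h2'
    · exact hpaZ ha'
  have hE : ¬ (p : ℤ) ∣ ((a : ℤ) - 2 * c) := by
    intro h
    exact hpaZ (by simpa using dvd_add h (dvd_mul_of_dvd_right hpcZ 2))
  -- nonvanishing
  have hc0 : (c : ℚ) ≠ 0 := by exact_mod_cast hc
  have hNz : ((a : ℤ) ^ 2 - a * c + (c : ℤ) ^ 2) ≠ 0 := fun h => hN (h ▸ dvd_zero _)
  have hSz : ((a : ℤ) + c) ≠ 0 := fun h => hS (h ▸ dvd_zero _)
  have hDz : (2 * (a : ℤ) - c) ≠ 0 := fun h => hD (h ▸ dvd_zero _)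
  have hEz : ((a : ℤ) - 2 * c) ≠ 0 := fun h => hE (h ▸ dvd_zero _)
  have hNq : ((a : ℚ) ^ 2 - a * c + (c : ℚ) ^ 2) ≠ 0 := by exact_mod_cast hNz
  have hSq : ((a : ℚ) + c) ≠ 0 := by exact_mod_cast hSz
  have hDq : (2 * (a : ℚ) - c) ≠ 0 := by exact_mod_cast hDz
  have hEq : ((a : ℚ) - 2 * c) ≠ 0 := by exact_mod_cast hEz
  have h2q : (2 : ℚ) ≠ 0 := by norm_num
  have hden : (2 : ℚ) * ((a : ℚ) + c) * (2 * (a : ℚ) - c) * ((a : ℚ) - 2 * c) ≠ 0 := by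
    simp [hSq, hDq, hEq]
  rw [RadTriple.gamma_legendre_eq a c hc hden]
  -- `ord` of the pieces
  have hordc : ord ℚ v (c : ℚ) = (c.factorization p : ℤ) := ord_natCast_eq_factorization v hc
  have hordN : ord ℚ v ((a : ℚ) ^ 2 - a * c + (c : ℚ) ^ 2) = 0 := by
    have : ((((a : ℤ) ^ 2 - a * c + (c : ℤ) ^ 2 : ℤ)) : ℚ) = (a : ℚ) ^ 2 - a * c + (c : ℚ) ^ 2 := by push_cast; ring
    rw [← this]; exact TameRobust.ord_intCast_eq_zero_of_not_dvd v hN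
  have hordS : ord ℚ v ((a : ℚ) + c) = 0 := by
    have : ((((a : ℤ) + c : ℤ)) : ℚ) = (a : ℚ) + c := by push_cast; ring
    rw [← this]; exact TameRobust.ord_intCast_eq_zero_of_not_dvd v hS
  have hordD : ord ℚ v (2 * (a : ℚ) - c) = 0 := by
    have : (((2 * (a : ℤ) - c : ℤ)) : ℚ) = 2 * (a : ℚ) - c := by push_cast; ring
    rw [← this]; exact TameRobust.ord_intCast_eq_zero_of_not_dvd v hD
  have hordE : ord ℚ v ((a : ℚ) - 2 * c) = 0 := by
    have : ((((a : ℤ) - 2 * c : ℤ)) : ℚ) = (a : ℚ) - 2 * c := by push_cast; ring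
    rw [← this]; exact TameRobust.ord_intCast_eq_zero_of_not_dvd v hE
  have hord2 : ord ℚ v (2 : ℚ) = 0 := by
    have : (((2 : ℤ)) : ℚ) = 2 := by push_cast; ring
    rw [← this]; exact TameRobust.ord_intCast_eq_zero_of_not_dvd v h2
  rw [neg_div, TameRobust.ord_neg_eq, div_eq_mul_inv, ord_mul ℚ v (mul_ne_zero hc0 hNq) (inv_ne_zero hden), ord_inv,
    ord_mul ℚ v hc0 hNq, ord_mul ℚ v (mul_ne_zero (mul_ne_zero h2q hSq) hDq) hEq,
    ord_mul ℚ v (mul_ne_zero h2q hSq) hDq, ord_mul ℚ v h2q hSq, hordc, hordN, hordS, hordD, hordE, hord2]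
  ring

/-! ## §2. Fibre form at the `K`-level pilot datum of a genuine datum over an abc triple, and the class with the twist clause -/

/-- **`p ∣ c`, `p ∉ {2, l}`, `v_p(c)` ODD ⟹ `2·l ∣ e(K_{x₀}/ℚ_p)` at EVERY fibre point `x₀ ∣ p`** of the `K`-level pilot datum of a genuine Θ-volume
datum over `(ratPoint (a/c), l)`: `ord_p γ(E_{a/c}) = v_p(c)` is odd (§1), `γ` is a square in `F_w` at the bad places over `p`
(`Cor312GenuineKTwistExact`). [cite: SilvermanATAEC1994, Lemma V.5.2 and Thm. V.5.3] [cite: Mochizuki2012, IUTchI Ex. 3.2 (iv) p. 71]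
[claim: Mochizuki2012, status: disputed] -/
theorem GenuineK.two_mul_prime_dvd_absRamificationIdx_kOf_triple_of_odd {a b c l : ℕ} (habc : IsABCTriple a b c)
    (T : Cor22.ThetaVolumeDatumAt (ratPoint ((a : ℚ) / c)) l) (pp : Nat.Primes) (hp2 : (pp : ℕ) ≠ 2) (hpl : (pp : ℕ) ≠ l)
    (hpc : (pp : ℕ) ∣ c) (hodd : Odd (c.factorization pp)) :
    letI := T.instFieldF; letI := T.instNumberFieldF; letI := T.instAlgebraF; letI := T.instFieldK
    letI := T.instNumberFieldK; letI := T.instAlgebraK; letI := T.instFieldFbar; letI := T.instAlgebraFbar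
    letI := T.instAlgebraKFbar; letI := T.instIsElliptic
    haveI : Fact (pp : ℕ).Prime := ⟨pp.2⟩
    ∀ x₀ : (thetaIndex (pilotDataOfK T.D T.K)).Fibre (.inr pp),
      2 * l ∣ absRamificationIdx (pp : ℕ) (kOf (pilotDataOfK T.D T.K) pp.1 x₀) := by
  have ha : 0 < a := habc.1
  have hb : 0 < b := habc.2.1
  have hc : 0 < c := by have := habc.2.2.1; omega
  have habc0 : a * b * c ≠ 0 := by positivity
  have hpabc : (pp : ℕ) ∣ a * b * c := dvd_mul_of_dvd_right hpc _
  have hpole : ∀ u : HeightOneSpectrum (𝓞 ℚ), Rat.HeightOneSpectrum.natGenerator u = (pp : ℕ) →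
      ord ℚ u (Cor22.jInv ((a : ℚ) / c)) < 0 := by
    intro u hu
    rw [Cor22.ord_jInv_ratPoint_triple_eq habc u (by rw [hu]; exact hp2) (by rw [hu]; exact hpabc), hu]
    have : 0 < (a * b * c).factorization pp := Nat.Prime.factorization_pos_of_dvd pp.2 habc0 hpabc
    have : (0 : ℤ) < ((a * b * c).factorization pp : ℕ) := by exact_mod_cast this
    linarith
  have hoddγ : ∀ u : HeightOneSpectrum (𝓞 ℚ), Rat.HeightOneSpectrum.natGenerator u = (pp : ℕ) →
      Odd (ord ℚ u (-((⟨0, -(1 + (a : ℚ) / c), 0, (a : ℚ) / c, 0⟩ : WeierstrassCurve ℚ).c₄ /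
        (⟨0, -(1 + (a : ℚ) / c), 0, (a : ℚ) / c, 0⟩ : WeierstrassCurve ℚ).c₆))) := by
    intro u hu
    rw [RadTriple.ord_gamma_legendre_eq_factorization habc u (by rw [hu]; exact hp2) (by rw [hu]; exact hpc), hu]
    obtain ⟨k, hk⟩ := hodd
    exact ⟨k, by rw [hk]; push_cast; ring⟩
  exact GenuineK.two_mul_prime_dvd_absRamificationIdx_kOf_of_odd_ord_gamma T pp hp2 hpl hpole hoddγ

/-- **The kernel class WITH THE TWIST CLAUSE at a tame pole of an abc triple**: every fibre point `x₀ ∣ p` (`p ∉ {2, 3, 5, l}`, `v = v_p(abc)`) has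
`e(K_{x₀}/ℚ_p) = A·l` with `A ∣ 30`, `15 ∣ A·v`, (`v` even ⇒ `A ∣ 15`), (`3 ∣ v` ⇒ `A ∣ 10`), (`5 ∣ v` ⇒ `A ∣ 6`), **(`p ∣ c` and `v` odd ⇒ `2 ∣ A`)**,
`p ∤ A·l` (`WRow.localType_class_triple_sharp` + `GenuineK.two_mul_prime_dvd_absRamificationIdx_kOf_triple_of_odd`; at `p ∣ c`, `v_p(abc) = v_p(c)`).
E.g. `19¹¹ ∥ c`: class `{30}`; `23⁵ ∥ c` (Reyssat): class `{6}`; `3677³ ∥ c`: class `{10}`. [cite: SilvermanATAEC1994, V.5 Thm. 5.3 and Cor. 5.4]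
[cite: Mochizuki2012, IUTchIV Thm. 1.10 p. 22 and proof Steps (ii)–(iii) p. 24–26] [claim: Mochizuki2012, status: disputed] -/
theorem WRow.localType_class_triple_twist {a b c l : ℕ} (habc : IsABCTriple a b c)
    (T : Cor22.ThetaVolumeDatumAt (ratPoint ((a : ℚ) / c)) l) (pp : Nat.Primes) (hp2 : (pp : ℕ) ≠ 2) (hp3 : (pp : ℕ) ≠ 3)
    (hp5 : (pp : ℕ) ≠ 5) (hpl : (pp : ℕ) ≠ l) (hpabc : (pp : ℕ) ∣ a * b * c) {v : ℕ} (hv : (a * b * c).factorization pp = v) :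
    letI := T.instFieldF; letI := T.instNumberFieldF; letI := T.instAlgebraF; letI := T.instFieldK
    letI := T.instNumberFieldK; letI := T.instAlgebraK; letI := T.instFieldFbar; letI := T.instAlgebraFbar
    letI := T.instAlgebraKFbar; letI := T.instIsElliptic
    haveI : Fact (pp : ℕ).Prime := ⟨pp.2⟩
    ∀ x₀ : (thetaIndex (pilotDataOfK T.D T.K)).Fibre (.inr pp),
      ∃ A : ℕ, absRamificationIdx (pp : ℕ) (kOf (pilotDataOfK T.D T.K) pp.1 x₀) = A * l ∧
        A ∣ 30 ∧ 15 ∣ A * v ∧ (Even v → A ∣ 15) ∧ (3 ∣ v → A ∣ 10) ∧ (5 ∣ v → A ∣ 6) ∧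
        ((pp : ℕ) ∣ c → Odd v → 2 ∣ A) ∧ ¬ (pp : ℕ) ∣ A * l := by
  letI := T.instFieldF; letI := T.instNumberFieldF; letI := T.instAlgebraF; letI := T.instFieldK
  letI := T.instNumberFieldK; letI := T.instAlgebraK; letI := T.instFieldFbar; letI := T.instAlgebraFbar
  letI := T.instAlgebraKFbar; letI := T.instIsElliptic
  haveI : Fact (pp : ℕ).Prime := ⟨pp.2⟩
  intro x₀
  obtain ⟨A, hA, h30, h15, hpar, h3, h5, hpe⟩ := WRow.localType_class_triple_sharp habc T pp hp2 hp3 hp5 hpl hpabc hv x₀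
  have hl0 : 0 < l := by have := T.D.five_le_l; omega
  refine ⟨A, hA, h30, h15, hpar, h3, h5, fun hpc hoddv => ?_, hpe⟩
  -- at `p ∣ c`: `v_p(abc) = v_p(c)`
  obtain ⟨ha, hb, hsum, hcop⟩ := habc
  have hc : c ≠ 0 := by omega
  have hcopac : Nat.Coprime a c := by rw [← hsum, Nat.coprime_self_add_right]; exact hcop
  have hcopbc : Nat.Coprime b c := by rw [← hsum, add_comm, Nat.coprime_self_add_right]; exact hcop.symm
  have hpa : ¬ (pp : ℕ) ∣ a := fun h => pp.2.one_lt.ne' (Nat.eq_one_of_dvd_coprimes hcopac h hpc)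
  have hpb : ¬ (pp : ℕ) ∣ b := fun h => pp.2.one_lt.ne' (Nat.eq_one_of_dvd_coprimes hcopbc h hpc)
  have hvc : c.factorization pp = v := by
    rw [← hv, Nat.factorization_mul (Nat.mul_ne_zero ha.ne' hb.ne') hc, Nat.factorization_mul ha.ne' hb.ne',
      Finsupp.add_apply, Finsupp.add_apply, Nat.factorization_eq_zero_of_not_dvd hpa,
      Nat.factorization_eq_zero_of_not_dvd hpb]
    ring
  have h2l := GenuineK.two_mul_prime_dvd_absRamificationIdx_kOf_triple_of_odd ⟨ha, hb, hsum, hcop⟩ T pp hp2 hpl hpc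
    (hvc ▸ hoddv) x₀
  rw [hA, mul_comm 2 l, mul_comm A l] at h2l
  exact Nat.dvd_of_mul_dvd_mul_left hl0 h2l

end Summit.ABC.IUTFork.Conditional

end
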